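import Literature.Topology.Euclidean.InvarianceOfDomain
import Mathlib.Topology.Homeomorph.Lemmas
import HarnessLib

/-!
# N1-move, bridge (e×) `piece_e_cross`, tool 1: lifts of annulus maps on the strip `ℝ × (−1, 1)`
(wave 8, worker J4, brick of stub `stub_M2geo` = node N1 ▸ contract `node_N1_move_of_pieces` ▸ `HD` =
`piece_e_cross piece_d`, line `modp-braid-orbits`, crux `ConvexBisection.AcyclicBisectionExists`, item
stmt-SmoothPoincare4-10508; registered sub-goal `helper_exists_inverse_stripMap`)

H4's two-sided belt chart (piece (d), `H4Interface.N1MonoStatement`) presents the across-belt monodromy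
by a RETURN MAP `G : ℝ × ℝ → ℝ × ℝ`, the lift of a self-map of the annulus `ℝ/ℤ × (−1, 1)`:
`G (u + 1, r) = G (u, r) + (1, 0)`, `G = id` for `r ≤ −1/2`, `G (u, r) = (u + n, r)` for `r ≥ 1/2`
(`n = ±1` the displacement), second coordinate kept in `(−1, 1)`.  The bridge (e×) from the chart to
the shadow-level monodromy `HD` consumed by `node_N1_move_of_pieces` reads the UPWARD crossing through
`G` and the DOWNWARD crossing through the INVERSE lift; this file supplies the inverse:

* `stripMap_int` — integer equivariance `G (u + m, r) = G (u, r) + (m, 0)`;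
* `stripMap_injective`, `stripMap_surjective` — a lift that is injective and surjective ON THE STRIP
  (which is what the injectivity and the cover clause of the belt chart give) is a bijection of `ℝ²`;
* **`exists_inverse_stripMap`** — its inverse is again a CONTINUOUS lift of the same kind with
  displacement `−n` (continuity by Brouwer's invariance of domain,
  `Literature.Topology.Euclidean.Brouwer.isOpenMap_of_injective`).

Everything is proved; no definitions, no named facts, no `sorry`.  Reference: T. Tao, *Hilbert's fifth
problem and related topics* (2014), Thm. 6.0.12 [Tao2014]. [folklore]
-/

noncomputable section

set_option linter.dupNamespace false

open Set Function

namespace Summit.SmoothPoincare4.SmoothPoincare4.Theorems.AcyclicBisectionExists.ModpBraidOrbits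

namespace CrossStrip

variable {G : ℝ × ℝ → ℝ × ℝ} {n : ℝ}

/-- **Integer equivariance** of a lift: `G (u + m, r) = G (u, r) + (m, 0)` for `m : ℤ`. [folklore] -/
theorem stripMap_int (hG1 : ∀ u r, G (u + 1, r) = G (u, r) + (1, 0)) (m : ℤ) (u r : ℝ) :
    G (u + m, r) = G (u, r) + ((m : ℝ), 0) := by
  induction m using Int.induction_on generalizing u with
  | zero => simp
  | succ k ih =>
    have h := hG1 (u + k) r
    have h' := ih u
    rw [add_assoc] at h
    push_cast at h' ⊢
    rw [h, h', add_assoc]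
    congr 1
    ext <;> simp
  | pred k ih =>
    have h := hG1 (u + (-(k : ℝ) - 1)) r
    rw [add_assoc, show -(k : ℝ) - 1 + 1 = -(k : ℝ) by ring] at h
    have h' := ih u
    push_cast at h' ⊢
    rw [h'] at h
    have e : G (u + (-(k : ℝ) - 1), r) = G (u, r) + (-(k : ℝ), 0) - (1, 0) := by
      rw [h]; simp
    rw [e, add_sub_assoc, Prod.mk_sub_mk, sub_zero]

/-- Outside the strip the lift is explicit: the identity below … [folklore] -/
theorem stripMap_of_le (hGlo : ∀ u r, r ≤ -(1 / 2 : ℝ) → G (u, r) = (u, r)) {p : ℝ × ℝ}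
    (hp : p.2 ≤ -1) : G p = p := by
  obtain ⟨u, r⟩ := p
  exact hGlo u r (by simp only at hp; linarith)

/-- … and the translation by the displacement above. [folklore] -/
theorem stripMap_of_ge (hGhi : ∀ u r, (1 / 2 : ℝ) ≤ r → G (u, r) = (u + n, r)) {p : ℝ × ℝ}
    (hp : 1 ≤ p.2) : G p = (p.1 + n, p.2) := by
  obtain ⟨u, r⟩ := p
  exact hGhi u r (by simp only at hp; linarith)

/-- The second coordinate of the image of a point off the strip is unchanged. [folklore] -/
theorem stripMap_snd_of_not_mem (hGlo : ∀ u r, r ≤ -(1 / 2 : ℝ) → G (u, r) = (u, r))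
    (hGhi : ∀ u r, (1 / 2 : ℝ) ≤ r → G (u, r) = (u + n, r)) {p : ℝ × ℝ}
    (hp : p.2 ∉ Ioo (-1 : ℝ) 1) : (G p).2 = p.2 := by
  rcases le_or_gt p.2 (-1) with h | h
  · rw [stripMap_of_le hGlo h]
  · have h1 : 1 ≤ p.2 := by
      by_contra h'
      exact hp ⟨h, lt_of_not_ge h'⟩
    rw [stripMap_of_ge hGhi h1]

/-- **A lift injective on the strip is injective on the plane.** [folklore] -/
theorem stripMap_injective (hGlo : ∀ u r, r ≤ -(1 / 2 : ℝ) → G (u, r) = (u, r))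
    (hGhi : ∀ u r, (1 / 2 : ℝ) ≤ r → G (u, r) = (u + n, r))
    (hGstrip : ∀ u r, r ∈ Ioo (-1 : ℝ) 1 → (G (u, r)).2 ∈ Ioo (-1 : ℝ) 1)
    (hGinj : ∀ p p' : ℝ × ℝ, p.2 ∈ Ioo (-1 : ℝ) 1 → p'.2 ∈ Ioo (-1 : ℝ) 1 → G p = G p' → p = p') :
    Injective G := by
  intro p p' h
  by_cases hp : p.2 ∈ Ioo (-1 : ℝ) 1 <;> by_cases hp' : p'.2 ∈ Ioo (-1 : ℝ) 1
  · exact hGinj p p' hp hp' h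
  · exfalso
    have h1 : (G p).2 ∈ Ioo (-1 : ℝ) 1 := hGstrip p.1 p.2 hp
    rw [h, stripMap_snd_of_not_mem hGlo hGhi hp'] at h1
    exact hp' h1
  · exfalso
    have h1 : (G p').2 ∈ Ioo (-1 : ℝ) 1 := hGstrip p'.1 p'.2 hp'
    rw [← h, stripMap_snd_of_not_mem hGlo hGhi hp] at h1
    exact hp h1
  · have h2 : p.2 = p'.2 := by
      rw [← stripMap_snd_of_not_mem hGlo hGhi hp, ← stripMap_snd_of_not_mem hGlo hGhi hp', h]
    rcases le_or_gt p.2 (-1) with hle | hgt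
    · have hle' : p'.2 ≤ -1 := h2 ▸ hle
      rwa [stripMap_of_le hGlo hle, stripMap_of_le hGlo hle'] at h
    · have h1 : 1 ≤ p.2 := by
        by_contra h'
        exact hp ⟨hgt, lt_of_not_ge h'⟩
      have h1' : 1 ≤ p'.2 := h2 ▸ h1
      rw [stripMap_of_ge hGhi h1, stripMap_of_ge hGhi h1'] at h
      simp only [Prod.mk.injEq, add_left_inj] at h
      exact Prod.ext h.1 h.2

/-- **A lift surjective onto the strip is surjective onto the plane.** [folklore] -/
theorem stripMap_surjective (hGlo : ∀ u r, r ≤ -(1 / 2 : ℝ) → G (u, r) = (u, r))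
    (hGhi : ∀ u r, (1 / 2 : ℝ) ≤ r → G (u, r) = (u + n, r))
    (hGsurj : ∀ q : ℝ × ℝ, q.2 ∈ Ioo (-1 : ℝ) 1 → ∃ p : ℝ × ℝ, p.2 ∈ Ioo (-1 : ℝ) 1 ∧ G p = q) :
    Surjective G := by
  intro q
  by_cases hq : q.2 ∈ Ioo (-1 : ℝ) 1
  · obtain ⟨p, -, hp⟩ := hGsurj q hq
    exact ⟨p, hp⟩
  · rcases le_or_gt q.2 (-1) with hle | hgt
    · exact ⟨q, stripMap_of_le hGlo hle⟩
    · have h1 : 1 ≤ q.2 := by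
        by_contra h'
        exact hq ⟨hgt, lt_of_not_ge h'⟩
      refine ⟨(q.1 - n, q.2), ?_⟩
      rw [stripMap_of_ge hGhi (show 1 ≤ ((q.1 - n, q.2) : ℝ × ℝ).2 from h1)]
      simp

/-- **The inverse lift.**  A continuous lift `G` of an annulus map (equivariant, the identity for
`r ≤ −1/2`, the translation by `n` for `r ≥ 1/2`, strip-preserving) which is injective and surjective
on the strip `ℝ × (−1, 1)` has a CONTINUOUS inverse lift `G'` of the same kind with displacement `−n`:
`G' ∘ G = id = G ∘ G'`.  Continuity of the inverse is Brouwer's invariance of domain.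
[cite: Tao2014, Thm. 6.0.12] -/
theorem exists_inverse_stripMap (hGc : Continuous G) (hG1 : ∀ u r, G (u + 1, r) = G (u, r) + (1, 0))
    (hGlo : ∀ u r, r ≤ -(1 / 2 : ℝ) → G (u, r) = (u, r))
    (hGhi : ∀ u r, (1 / 2 : ℝ) ≤ r → G (u, r) = (u + n, r))
    (hGstrip : ∀ u r, r ∈ Ioo (-1 : ℝ) 1 → (G (u, r)).2 ∈ Ioo (-1 : ℝ) 1)
    (hGinj : ∀ p p' : ℝ × ℝ, p.2 ∈ Ioo (-1 : ℝ) 1 → p'.2 ∈ Ioo (-1 : ℝ) 1 → G p = G p' → p = p')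
    (hGsurj : ∀ q : ℝ × ℝ, q.2 ∈ Ioo (-1 : ℝ) 1 → ∃ p : ℝ × ℝ, p.2 ∈ Ioo (-1 : ℝ) 1 ∧ G p = q) :
    ∃ G' : ℝ × ℝ → ℝ × ℝ, Continuous G' ∧ (∀ p, G' (G p) = p) ∧ (∀ q, G (G' q) = q) ∧
      (∀ u r, G' (u + 1, r) = G' (u, r) + (1, 0)) ∧
      (∀ u r, r ≤ -(1 / 2 : ℝ) → G' (u, r) = (u, r)) ∧
      (∀ u r, (1 / 2 : ℝ) ≤ r → G' (u, r) = (u + -n, r)) ∧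
      (∀ u r, r ∈ Ioo (-1 : ℝ) 1 → (G' (u, r)).2 ∈ Ioo (-1 : ℝ) 1) := by
  have hinj : Injective G := stripMap_injective hGlo hGhi hGstrip hGinj
  have hsurj : Surjective G := stripMap_surjective hGlo hGhi hGsurj
  have hopen : IsOpenMap G :=
    Literature.Topology.Euclidean.Brouwer.isOpenMap_of_injective rfl hGc hinj
  set e : ℝ × ℝ ≃ₜ ℝ × ℝ := (Equiv.ofBijective G ⟨hinj, hsurj⟩).toHomeomorphOfContinuousOpen hGc hopen
    with he
  have heG : ∀ p, e p = G p := fun p => rfl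
  have hl : ∀ p, e.symm (G p) = p := fun p => by rw [← heG, Homeomorph.symm_apply_apply]
  have hr : ∀ q, G (e.symm q) = q := fun q => by rw [← heG, Homeomorph.apply_symm_apply]
  refine ⟨e.symm, e.symm.continuous, hl, hr, fun u r => ?_, fun u r hr0 => ?_, fun u r hr0 => ?_,
    fun u r hr0 => ?_⟩
  · apply hinj
    rw [hr]
    have h1 := hG1 (e.symm (u, r)).1 (e.symm (u, r)).2
    rw [Prod.mk.eta, hr] at h1
    have h2 : e.symm (u, r) + (1, 0) = ((e.symm (u, r)).1 + 1, (e.symm (u, r)).2) :=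
      Prod.ext rfl (add_zero _)
    rw [h2, h1]
    exact Prod.ext rfl (add_zero _).symm
  · apply hinj
    rw [hr, hGlo u r hr0]
  · apply hinj
    rw [hr, hGhi (u + -n) r hr0, neg_add_cancel_right]
  · by_contra hcon
    have h1 := stripMap_snd_of_not_mem hGlo hGhi (p := e.symm (u, r)) hcon
    rw [hr] at h1
    exact hcon (h1 ▸ hr0)

end CrossStrip

open CrossStrip

/-! ## The registered form -/

/-- **Sub-goal `helper_exists_inverse_stripMap`** (J4, bridge (e×) of the N1 contract, tool 1,
fully qualified): the inverse of the return map of H4's two-sided belt chart — a continuous lift of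
an annulus map, the identity below `r = −1/2`, the translation by `n` above `r = 1/2`, injective and
surjective on the strip — is a continuous lift of the same kind with displacement `−n`.
[cite: Tao2014, Thm. 6.0.12] -/
theorem helper_exists_inverse_stripMap : ∀ (G : ℝ × ℝ → ℝ × ℝ) (n : ℝ), Continuous G → (∀ u r, G (u + 1, r) = G (u, r) + (1, 0)) → (∀ u r, r ≤ -(1 / 2 : ℝ) → G (u, r) = (u, r)) → (∀ u r, (1 / 2 : ℝ) ≤ r → G (u, r) = (u + n, r)) → (∀ u r, r ∈ Set.Ioo (-1 : ℝ) 1 → (G (u, r)).2 ∈ Set.Ioo (-1 : ℝ) 1) → (∀ p p' : ℝ × ℝ, p.2 ∈ Set.Ioo (-1 : ℝ) 1 → p'.2 ∈ Set.Ioo (-1 : ℝ) 1 → G p = G p' → p = p') → (∀ q : ℝ × ℝ, q.2 ∈ Set.Ioo (-1 : ℝ) 1 → ∃ p : ℝ × ℝ, p.2 ∈ Set.Ioo (-1 : ℝ) 1 ∧ G p = q) → ∃ G' : ℝ × ℝ → ℝ × ℝ, Continuous G' ∧ (∀ p, G' (G p) = p) ∧ (∀ q, G (G' q) = q) ∧ (∀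 u r, G' (u + 1, r) = G' (u, r) + (1, 0)) ∧ (∀ u r, r ≤ -(1 / 2 : ℝ) → G' (u, r) = (u, r)) ∧ (∀ u r, (1 / 2 : ℝ) ≤ r → G' (u, r) = (u + -n, r)) ∧ (∀ u r, r ∈ Set.Ioo (-1 : ℝ) 1 → (G' (u, r)).2 ∈ Set.Ioo (-1 : ℝ) 1) :=
  fun _ _ hGc hG1 hGlo hGhi hGstrip hGinj hGsurj =>
    exists_inverse_stripMap hGc hG1 hGlo hGhi hGstrip hGinj hGsurj

end Summit.SmoothPoincare4.SmoothPoincare4.Theorems.AcyclicBisectionExists.ModpBraidOrbits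

end
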